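import Literature.NumberTheory.Automorphic.UnitaryGroupSelfDualLocus   -- ★ L1 (B-p14): `glInt`, `unitaryGroupOfForm`, `formCongr`, `exists_mem_unitaryGroupOfForm_mul_iff`
import HarnessLib

/-!
# `γ`-fixed cosets of `G ⧸ K` are `γ`-stable lattices: the dictionary between ★ L2's fixed-point count `#Fix_γ(G ⧸ K)` and the lattice
# counts of the inert unit fundamental lemma (`G = GL_n(F) ⊃ K = GL_n(𝒪)`, and `U(J) ⊃ U(J)(𝒪)` over ★ L1)
(Kottwitz, *Base change for unit elements of Hecke algebras* (1986), §3; Laumon, *Cohomology of Drinfeld modular varieties* I (1996),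
(4.3.11), Lemma (5.3.2); Rogawski (1990), §4.9 Prop. 4.9.1 (b), Lemma 4.9.3)

Topic `NumberTheory/Automorphic`; namespace `Literature.NumberTheory.Automorphic`.  THEOREMS ONLY (no definition, no instance, no notation, no named
fact, no `sorry`).  Cell `pub/hodgecm-mathlib`, F0∕P3a, road «D-N7-inert» (A-p06 (g25) map 84809157: (L1) ★ `UnitaryGroupSelfDualLocus`, (L2) ★
`UnitOrbitalIntegralFixedPoints` ∕ ★ `OrbitalIntegralFixedPointCount`, (L3) the count — held), brick (D4½) «γ-FIXED COSETS = γ-STABLE LATTICES»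
(LEAD F0P3a-plan (g9) WORD T8-18 (D)(1)).  HC_CM is proved only modulo the printed citations until rung 0 closes; nothing printed is asserted here.

THE MATHEMATICS.  (§1) For a group `G`, a subgroup `K` and `γ ∈ G`, the coset `gK` is fixed by `γ` iff `g⁻¹ γ g ∈ K`; for ANY `G`-set `X` and
`x₀ ∈ X` with stabiliser `K`, `gK ↦ g x₀` restricts to a bijection `Fix_γ(G ⧸ K) ≃ {x ∈ G·x₀ | γ x = x}` (Mathlib `orbitEquivQuotientStabilizer`).
(§2) For `G = GL_n(F)`, `F` a field with a valuation (Mathlib `ValuativeRel`, `𝒪 = 𝒪[F]`), `K = GL_n(𝒪) = glInt n F`, the `G`-set is the set of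
`𝒪`-lattices in `Fⁿ` and `x₀ = 𝒪ⁿ`; we write NO action and NO definition: the lattice of `g` is the EXPRESSION `Λ(g) := 𝒪-span of the columns of g`
`= Submodule.span 𝒪[F] (Set.range (↑g)ᵀ)`, so that `Λ(1) = 𝒪ⁿ` (`mem_span_range_transpose_one_iff`), `Λ(g h) = g · Λ(h)` (`span_range_transpose_mul`),
**`Λ(k) = 𝒪ⁿ ↔ k ∈ GL_n(𝒪)`** (`span_range_transpose_eq_one_iff_mem_glInt`: columns integral, and `e_j ∈ Λ(k)` makes `k⁻¹` integral),
`Λ(g) = Λ(g′) ↔ g⁻¹ g′ ∈ GL_n(𝒪)`, and THE DICTIONARY **`γ · Λ(g) = Λ(g) ↔ γ · gK = gK`** (`map_span_range_transpose_eq_self_iff_smul_mk_eq`); whence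
`gK ↦ Λ(g)` is a bijection from `Fix_γ(G ⧸ K)` onto the `γ`-stable lattices in the orbit `{Λ(g)}` and **`Nat.card Fix_γ(GL_n(F) ⧸ GL_n(𝒪)) =
#{Λ = Λ(g) | γ Λ = Λ}`** (`natCard_fixedBy_glInt_eq_ncard`; `encard` form without finiteness).  (§3) The same for the unitary group `U = U(J) ≤ GL_n(E)`
of a form and `K_U = U ∩ GL_n(𝒪)` (★ L1's currency): `Nat.card Fix_γ(U ⧸ K_U) = #{Λ = Λ(u), u ∈ U | γ Λ = Λ}`, and by ★ L1
(`exists_mem_unitaryGroupOfForm_mul_iff`: the self-dual locus is `U · GL_n(𝒪)`) the lattices `Λ(u)`, `u ∈ U`, are exactly the `Λ(g)` with UNIMODULAR GRAM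
MATRIX `(σg)ᵀ J g ∈ GL_n(𝒪)` — the self-dual lattices [Jacobowitz1962]; so the fixed-point count of ★ L2 IS the number of `γ`-stable self-dual lattices
that (L3) computes.  The coordinate-free reading «unimodular Gram matrix ↔ `Λ^∨ = Λ`» is ★ `SelfDualHermitianLatticesUpToScalar` (cited, not restated).

HEADS: §1 `smul_mk_eq_mk_iff_inv_conj_mem`, `mem_fixedBy_quotient_mk_iff`, `fixedBy_quotient_eq_image_mk`, `exists_equiv_fixedBy_quotient_stabilizer`,
`natCard_fixedBy_quotient_stabilizer_eq`; §2 `mem_span_range_transpose_one_iff`, `span_range_transpose_mul`, `span_range_transpose_eq_one_iff_mem_glInt`,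
`span_range_transpose_eq_iff`, `map_span_range_transpose_eq_self_iff(_smul_mk_eq)`, `image_fixedBy_glInt_eq`, `natCard_fixedBy_glInt_eq_ncard`,
`encard_fixedBy_glInt_eq`, `exists_equiv_fixedBy_glInt`; §3 `map_span_range_transpose_eq_self_iff_smul_mk_eq_unitary`, `natCard_fixedBy_unitary_eq_ncard`,
`exists_mem_unitary_span_eq_iff_selfDual`.
NOT here: «every full `𝒪`-lattice of `Fⁿ` is some `Λ(g)`» (freeness over the DVR — only needed if a consumer enumerates ALL lattices rather than the
`GL_n(F)`-orbit of `𝒪ⁿ`); the bridge to the `Valued`-currency ★ `UnitaryAntidiagFrames.stdLattice` (Tits frames); any count.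

## References
* [Kottwitz1986] R. E. Kottwitz, *Base change for unit elements of Hecke algebras*, Compositio Math. 60 (1986), §3. [Laumon1995] G. Laumon,
  *Cohomology of Drinfeld Modular Varieties* I (1996), (4.3.11) p. 83, Lemma (5.3.2) p. 136. [Rogawski1990] J. D. Rogawski, *Automorphic Representations
  of Unitary Groups in Three Variables* (1990), §4.9 Prop. 4.9.1 (b) p. 55, Lemma 4.9.3. [Jacobowitz1962] R. Jacobowitz, *Hermitian forms over local
  fields*, Amer. J. Math. 84 (1962), §7 Thm. 7.1. [Kottwitz1992] R. E. Kottwitz, *Points on some Shimura varieties over finite fields*, JAMS 5 (1992), §7.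
-/

set_option autoImplicit false
noncomputable section
open scoped ValuativeRel Matrix MatrixGroups
open Set
namespace Literature.NumberTheory.Automorphic
/-! ## §1 Fixed cosets, abstractly -/
section Generic
variable {G : Type*} [Group G] (K : Subgroup G) (γ : G)
/-- **`γ · gK = gK ↔ g⁻¹ γ g ∈ K`** (companion of ★ `conj_mem_iff_smul_mk_eq`, which is the `g ↦ g⁻¹` reading). [cite: Laumon1995, Lemma (5.3.2) p. 136] -/
theorem smul_mk_eq_mk_iff_inv_conj_mem (g : G) : γ • ((g : G) : G ⧸ K) = (g : G ⧸ K) ↔ g⁻¹ * γ * g ∈ K := by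
  rw [MulAction.Quotient.smul_coe, smul_eq_mul, QuotientGroup.eq]
  have h1 : (γ * g)⁻¹ * g = (g⁻¹ * γ * g)⁻¹ := by group
  rw [h1, inv_mem_iff]

/-- `gK ∈ Fix_γ(G ⧸ K) ↔ g⁻¹ γ g ∈ K`. [cite: Laumon1995, Lemma (5.3.2) p. 136] -/
theorem mem_fixedBy_quotient_mk_iff (g : G) : (g : G ⧸ K) ∈ MulAction.fixedBy (G ⧸ K) γ ↔ g⁻¹ * γ * g ∈ K := by
  rw [MulAction.mem_fixedBy, smul_mk_eq_mk_iff_inv_conj_mem]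

/-- `Fix_γ(G ⧸ K)` is the image of `{g | g⁻¹ γ g ∈ K}`. [cite: Laumon1995, Lemma (5.3.2) p. 136] -/
theorem fixedBy_quotient_eq_image_mk : MulAction.fixedBy (G ⧸ K) γ = QuotientGroup.mk '' {g : G | g⁻¹ * γ * g ∈ K} := by
  ext x
  induction x using QuotientGroup.induction_on with
  | H g =>
    rw [mem_fixedBy_quotient_mk_iff, mem_image]
    constructor
    · exact fun h => ⟨g, h, rfl⟩
    · rintro ⟨g', hg', hgg'⟩
      exact (mem_fixedBy_quotient_mk_iff K γ g).1 (hgg' ▸ (mem_fixedBy_quotient_mk_iff K γ g').2 hg')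

/-- **THE ABSTRACT DICTIONARY**: for any `G`-set `X` and `x₀ ∈ X`, `gK ↦ g x₀` (`K = Stab(x₀)`) is a bijection from the `γ`-fixed cosets onto the
`γ`-fixed points of the orbit: `Fix_γ(G ⧸ Stab x₀) ≃ {x ∈ G·x₀ | γ x = x}` (Mathlib `MulAction.orbitEquivQuotientStabilizer`, restricted). With `X` = lattices,
`x₀ = 𝒪ⁿ`: «`γ`-fixed cosets of `G ⧸ K` = `γ`-stable lattices in the class of `𝒪ⁿ`». [cite: Kottwitz1986, §3] [cite: Laumon1995, (4.3.11) p. 83] -/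
theorem exists_equiv_fixedBy_quotient_stabilizer {X : Type*} [MulAction G X] (x₀ : X) :
    ∃ e : MulAction.fixedBy (G ⧸ MulAction.stabilizer G x₀) γ ≃ {x : MulAction.orbit G x₀ // γ • (x : X) = x},
      ∀ (g : G) (h : ((g : G ⧸ MulAction.stabilizer G x₀)) ∈ MulAction.fixedBy (G ⧸ MulAction.stabilizer G x₀) γ),
        ((e ⟨(g : G ⧸ MulAction.stabilizer G x₀), h⟩ : MulAction.orbit G x₀) : X) = g • x₀ := by
  have key : ∀ q : G ⧸ MulAction.stabilizer G x₀, q ∈ MulAction.fixedBy (G ⧸ MulAction.stabilizer G x₀) γ ↔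
      γ • (((MulAction.orbitEquivQuotientStabilizer G x₀).symm q : MulAction.orbit G x₀) : X) =
        ((MulAction.orbitEquivQuotientStabilizer G x₀).symm q : MulAction.orbit G x₀) := by
    intro q
    induction q using QuotientGroup.induction_on with
    | H g =>
      rw [mem_fixedBy_quotient_mk_iff, MulAction.mem_stabilizer_iff, MulAction.orbitEquivQuotientStabilizer_symm_apply,
        mul_smul, mul_smul, inv_smul_eq_iff]
  refine ⟨(MulAction.orbitEquivQuotientStabilizer G x₀).symm.subtypeEquiv key, fun g h => ?_⟩
  rw [Equiv.subtypeEquiv_apply]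
  exact MulAction.orbitEquivQuotientStabilizer_symm_apply G x₀ g

/-- Cardinality form: `Nat.card Fix_γ(G ⧸ Stab x₀) = Nat.card {x ∈ G·x₀ | γ x = x}`. [cite: Kottwitz1986, §3] -/
theorem natCard_fixedBy_quotient_stabilizer_eq {X : Type*} [MulAction G X] (x₀ : X) :
    Nat.card (MulAction.fixedBy (G ⧸ MulAction.stabilizer G x₀) γ) = Nat.card {x : MulAction.orbit G x₀ // γ • (x : X) = x} := by
  obtain ⟨e, -⟩ := exists_equiv_fixedBy_quotient_stabilizer γ x₀
  exact Nat.card_congr e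
end Generic

/-! ## §2 `GL_n(F) ⊃ GL_n(𝒪)`: the lattice `Λ(g) = 𝒪-span of the columns of g` -/
section GLn
variable {F : Type*} [Field F] [ValuativeRel F] {n : ℕ}
omit [ValuativeRel F] in
/-- `g · (j-th column of h) = j-th column of g h`. [cite: Laumon1995, (4.3.11) p. 83] -/
theorem mulVec_transpose_apply (A B : Matrix (Fin n) (Fin n) F) (j : Fin n) : A *ᵥ (Bᵀ j) = (A * B)ᵀ j := by
  funext i
  simp [Matrix.mulVec, dotProduct, Matrix.mul_apply, Matrix.transpose_apply]

omit [ValuativeRel F] in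
/-- `A w = Σ_j w_j · (j-th column of A)`. [cite: Laumon1995, (4.3.11) p. 83] -/
theorem mulVec_eq_sum_smul_transpose (A : Matrix (Fin n) (Fin n) F) (w : Fin n → F) : A *ᵥ w = ∑ j, w j • Aᵀ j := by
  funext i
  simp [Matrix.mulVec, dotProduct, Finset.sum_apply, Pi.smul_apply, Matrix.transpose_apply, mul_comm]

/-- **`Λ(1) = 𝒪ⁿ`**: `v` lies in the `𝒪`-span of the standard basis iff all its coordinates are integral. [cite: Laumon1995, (4.3.11) p. 83] -/
theorem mem_span_range_transpose_one_iff (v : Fin n → F) :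
    v ∈ Submodule.span 𝒪[F] (Set.range (1 : Matrix (Fin n) (Fin n) F)ᵀ) ↔ ∀ i, v i ∈ 𝒪[F] := by
  rw [Matrix.transpose_one, Submodule.mem_span_range_iff_exists_fun]
  constructor
  · rintro ⟨c, rfl⟩ i
    rw [Finset.sum_apply]
    simp only [show ∀ (a : 𝒪[F]) (w : Fin n → F) (k : Fin n), (a • w) k = (a : F) * w k from fun _ _ _ => rfl, Matrix.one_apply,
      mul_ite, mul_one, mul_zero, Finset.sum_ite_eq', Finset.mem_univ, if_true]
    exact (c i).2
  · intro hv
    refine ⟨fun i => ⟨v i, hv i⟩, ?_⟩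
    funext k
    rw [Finset.sum_apply]
    simp only [show ∀ (a : 𝒪[F]) (w : Fin n → F) (k : Fin n), (a • w) k = (a : F) * w k from fun _ _ _ => rfl, Matrix.one_apply,
      mul_ite, mul_one, mul_zero, Finset.sum_ite_eq', Finset.mem_univ, if_true]

/-- **`Λ(g h) = g · Λ(h)`**: the span of the columns of `g h` is the image of the span of the columns of `h` under `g`. [cite: Laumon1995, (4.3.11) p. 83] -/
theorem span_range_transpose_mul (g h : Matrix (Fin n) (Fin n) F) :
    Submodule.span 𝒪[F] (Set.range (g * h)ᵀ) =
      (Submodule.span 𝒪[F] (Set.range hᵀ)).map ((Matrix.toLin' g).restrictScalars 𝒪[F]) := by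
  rw [Submodule.map_span, ← Set.range_comp]
  congr 1

/-- `Λ(g) ≤ 𝒪ⁿ ↔ g` has integral entries. [cite: Laumon1995, (4.3.11) p. 83] -/
theorem span_range_transpose_le_one_iff (g : Matrix (Fin n) (Fin n) F) :
    Submodule.span 𝒪[F] (Set.range gᵀ) ≤ Submodule.span 𝒪[F] (Set.range (1 : Matrix (Fin n) (Fin n) F)ᵀ) ↔ ∀ i j, g i j ∈ 𝒪[F] := by
  rw [Submodule.span_le, Set.range_subset_iff]
  constructor
  · intro h i j
    exact (mem_span_range_transpose_one_iff _).1 (h j) i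
  · intro h j
    exact (mem_span_range_transpose_one_iff _).2 fun i => h i j

/-- `𝒪ⁿ ≤ Λ(g) ↔ g⁻¹` has integral entries (`e_j = Σ_i (g⁻¹)_{ij} · g_i`, `g_i` the columns of `g`; conversely a relation `e_j = Σ c_i g_i` with
`c ∈ 𝒪ⁿ` forces `g⁻¹ e_j = c`). [cite: Laumon1995, (4.3.11) p. 83] -/
theorem one_le_span_range_transpose_iff (g : GL (Fin n) F) :
    Submodule.span 𝒪[F] (Set.range (1 : Matrix (Fin n) (Fin n) F)ᵀ) ≤
        Submodule.span 𝒪[F] (Set.range ((g : Matrix (Fin n) (Fin n) F))ᵀ) ↔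
      ∀ i j, ((g⁻¹ : GL (Fin n) F) : Matrix (Fin n) (Fin n) F) i j ∈ 𝒪[F] := by
  have hcol : ∀ j : Fin n, (1 : Matrix (Fin n) (Fin n) F)ᵀ j =
      ∑ i, ((g⁻¹ : GL (Fin n) F) : Matrix (Fin n) (Fin n) F) i j • ((g : Matrix (Fin n) (Fin n) F))ᵀ i := by
    intro j
    have h1 : (1 : Matrix (Fin n) (Fin n) F) = (g : Matrix (Fin n) (Fin n) F) * ((g⁻¹ : GL (Fin n) F) : Matrix (Fin n) (Fin n) F) := by
      rw [← Units.val_mul, mul_inv_cancel, Units.val_one]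
    rw [h1, ← mulVec_transpose_apply, mulVec_eq_sum_smul_transpose]
    rfl
  rw [Submodule.span_le, Set.range_subset_iff]
  constructor
  · intro h i j
    obtain ⟨c, hc⟩ := (Submodule.mem_span_range_iff_exists_fun 𝒪[F]).1 (h j)
    -- `g c = e_j`, so `c = g⁻¹ e_j = (g⁻¹)ᵀ j`
    have hc' : (g : Matrix (Fin n) (Fin n) F) *ᵥ (fun i => (c i : F)) = (1 : Matrix (Fin n) (Fin n) F)ᵀ j := by
      rw [mulVec_eq_sum_smul_transpose, ← hc]
      rfl
    have hc'' : (fun i => (c i : F)) = ((g⁻¹ : GL (Fin n) F) : Matrix (Fin n) (Fin n) F)ᵀ j := by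
      have h2 := congrArg (fun w => ((g⁻¹ : GL (Fin n) F) : Matrix (Fin n) (Fin n) F) *ᵥ w) hc'
      simp only [Matrix.mulVec_mulVec, ← Units.val_mul, inv_mul_cancel, Units.val_one, Matrix.one_mulVec] at h2
      rw [h2, mulVec_transpose_apply, Matrix.mul_one]
    have h3 := congrFun hc'' i
    simp only [Matrix.transpose_apply] at h3
    rw [← h3]
    exact (c i).2
  · intro h j
    rw [hcol j]
    exact Submodule.sum_mem _ fun i _ =>
      Submodule.smul_mem _ (⟨_, h i j⟩ : 𝒪[F]) (Submodule.subset_span ⟨i, rfl⟩)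

/-- **`Λ(k) = 𝒪ⁿ ↔ k ∈ GL_n(𝒪)`**: the stabiliser of the standard lattice in `GL_n(F)` is `GL_n(𝒪) = glInt n F` (★ `mem_glInt_iff`: `k`, `k⁻¹` integral).
[cite: Kottwitz1986, §3] [cite: Laumon1995, (4.3.11) p. 83] -/
theorem span_range_transpose_eq_one_iff_mem_glInt (k : GL (Fin n) F) :
    Submodule.span 𝒪[F] (Set.range ((k : Matrix (Fin n) (Fin n) F))ᵀ) = Submodule.span 𝒪[F] (Set.range (1 : Matrix (Fin n) (Fin n) F)ᵀ) ↔
      k ∈ glInt n F := by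
  rw [le_antisymm_iff, span_range_transpose_le_one_iff, one_le_span_range_transpose_iff, mem_glInt_iff]

/-- `g` acts injectively on lattices (`toLin' g` is invertible). [cite: Laumon1995, (4.3.11) p. 83] -/
theorem map_toLin'_injective (g : GL (Fin n) F) :
    Function.Injective (Submodule.map ((Matrix.toLin' (g : Matrix (Fin n) (Fin n) F)).restrictScalars 𝒪[F]) :
      Submodule 𝒪[F] (Fin n → F) → Submodule 𝒪[F] (Fin n → F)) := by
  refine Submodule.map_injective_of_injective fun v w hvw => ?_
  have h := congrArg (fun x => ((g⁻¹ : GL (Fin n) F) : Matrix (Fin n) (Fin n) F) *ᵥ x) hvw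
  simpa only [LinearMap.coe_restrictScalars, Matrix.toLin'_apply, Matrix.mulVec_mulVec, ← Units.val_mul, inv_mul_cancel,
    Units.val_one, Matrix.one_mulVec] using h

/-- **`Λ(g) = Λ(g′) ↔ g⁻¹ g′ ∈ GL_n(𝒪)`**: two elements give the same lattice iff they lie in the same coset of `K = GL_n(𝒪)`.
[cite: Kottwitz1986, §3] [cite: Laumon1995, (4.3.11) p. 83] -/
theorem span_range_transpose_eq_iff (g g' : GL (Fin n) F) :
    Submodule.span 𝒪[F] (Set.range ((g : Matrix (Fin n) (Fin n) F))ᵀ) = Submodule.span 𝒪[F] (Set.range ((g' : Matrix (Fin n) (Fin n) F))ᵀ) ↔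
      g⁻¹ * g' ∈ glInt n F := by
  have h1 : Submodule.span 𝒪[F] (Set.range ((g' : Matrix (Fin n) (Fin n) F))ᵀ) =
      (Submodule.span 𝒪[F] (Set.range (((g⁻¹ * g' : GL (Fin n) F) : Matrix (Fin n) (Fin n) F))ᵀ)).map
        ((Matrix.toLin' (g : Matrix (Fin n) (Fin n) F)).restrictScalars 𝒪[F]) := by
    rw [← span_range_transpose_mul, ← Units.val_mul, mul_inv_cancel_left]
  have h2 : Submodule.span 𝒪[F] (Set.range ((g : Matrix (Fin n) (Fin n) F))ᵀ) =
      (Submodule.span 𝒪[F] (Set.range (1 : Matrix (Fin n) (Fin n) F)ᵀ)).map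
        ((Matrix.toLin' (g : Matrix (Fin n) (Fin n) F)).restrictScalars 𝒪[F]) := by
    rw [← span_range_transpose_mul, Matrix.mul_one]
  rw [← span_range_transpose_eq_one_iff_mem_glInt, h1, h2, (map_toLin'_injective g).eq_iff, eq_comm]

/-- `γ · Λ(g) = Λ(g) ↔ g⁻¹ γ g ∈ GL_n(𝒪)`. [cite: Kottwitz1986, §3] [cite: Laumon1995, Lemma (5.3.2) p. 136] -/
theorem map_span_range_transpose_eq_self_iff (γ g : GL (Fin n) F) :
    (Submodule.span 𝒪[F] (Set.range ((g : Matrix (Fin n) (Fin n) F))ᵀ)).map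
        ((Matrix.toLin' (γ : Matrix (Fin n) (Fin n) F)).restrictScalars 𝒪[F]) =
      Submodule.span 𝒪[F] (Set.range ((g : Matrix (Fin n) (Fin n) F))ᵀ) ↔ g⁻¹ * γ * g ∈ glInt n F := by
  rw [← span_range_transpose_mul, ← Units.val_mul, span_range_transpose_eq_iff, mul_inv_rev]
  have h1 : g⁻¹ * γ⁻¹ * g = (g⁻¹ * γ * g)⁻¹ := by group
  rw [h1, inv_mem_iff]

/-- **THE DICTIONARY: `γ · Λ(g) = Λ(g) ↔ γ · gK = gK`** (`K = GL_n(𝒪)`): the `γ`-stable lattices in the class of `𝒪ⁿ` are the `γ`-fixed cosets of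
`GL_n(F) ⧸ GL_n(𝒪)`. [cite: Kottwitz1986, §3] [cite: Laumon1995, Lemma (5.3.2) p. 136] -/
theorem map_span_range_transpose_eq_self_iff_smul_mk_eq (γ g : GL (Fin n) F) :
    (Submodule.span 𝒪[F] (Set.range ((g : Matrix (Fin n) (Fin n) F))ᵀ)).map
        ((Matrix.toLin' (γ : Matrix (Fin n) (Fin n) F)).restrictScalars 𝒪[F]) =
      Submodule.span 𝒪[F] (Set.range ((g : Matrix (Fin n) (Fin n) F))ᵀ) ↔ γ • ((g : GL (Fin n) F) : GL (Fin n) F ⧸ glInt n F) = g := by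
  rw [map_span_range_transpose_eq_self_iff, smul_mk_eq_mk_iff_inv_conj_mem]

/-- The lattice of a coset does not depend on the representative: `Λ(out (gK)) = Λ(g)`. [cite: Kottwitz1986, §3] -/
theorem span_range_transpose_out_eq (g : GL (Fin n) F) :
    Submodule.span 𝒪[F] (Set.range ((((g : GL (Fin n) F ⧸ glInt n F).out : GL (Fin n) F) : Matrix (Fin n) (Fin n) F))ᵀ) =
      Submodule.span 𝒪[F] (Set.range ((g : Matrix (Fin n) (Fin n) F))ᵀ) := by
  obtain ⟨k, hk⟩ := QuotientGroup.mk_out_eq_mul (glInt n F) g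
  rw [hk, eq_comm, span_range_transpose_eq_iff, inv_mul_cancel_left]
  exact k.2

/-- **`gK ↦ Λ(g)` maps `Fix_γ(GL_n(F) ⧸ GL_n(𝒪))` ONTO the `γ`-stable lattices in the class of `𝒪ⁿ`.** [cite: Kottwitz1986, §3] [cite: Laumon1995, Lemma (5.3.2) p. 136] -/
theorem image_fixedBy_glInt_eq (γ : GL (Fin n) F) :
    (fun q : GL (Fin n) F ⧸ glInt n F => Submodule.span 𝒪[F] (Set.range (((q.out : GL (Fin n) F) : Matrix (Fin n) (Fin n) F))ᵀ)) ''
        MulAction.fixedBy (GL (Fin n) F ⧸ glInt n F) γ =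
      {Λ : Submodule 𝒪[F] (Fin n → F) |
        (∃ g : GL (Fin n) F, Λ = Submodule.span 𝒪[F] (Set.range ((g : Matrix (Fin n) (Fin n) F))ᵀ)) ∧
          Λ.map ((Matrix.toLin' (γ : Matrix (Fin n) (Fin n) F)).restrictScalars 𝒪[F]) = Λ} := by
  ext Λ
  simp only [mem_image, mem_setOf_eq]
  constructor
  · rintro ⟨q, hq, rfl⟩
    induction q using QuotientGroup.induction_on with
    | H g =>
      rw [span_range_transpose_out_eq]
      exact ⟨⟨g, rfl⟩, (map_span_range_transpose_eq_self_iff_smul_mk_eq γ g).2 hq⟩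
  · rintro ⟨⟨g, rfl⟩, hΛ⟩
    exact ⟨(g : GL (Fin n) F ⧸ glInt n F), (map_span_range_transpose_eq_self_iff_smul_mk_eq γ g).1 hΛ, span_range_transpose_out_eq g⟩

/-- `gK ↦ Λ(g)` is injective on cosets. [cite: Kottwitz1986, §3] -/
theorem injOn_span_out_glInt (S : Set (GL (Fin n) F ⧸ glInt n F)) :
    Set.InjOn (fun q : GL (Fin n) F ⧸ glInt n F =>
      Submodule.span 𝒪[F] (Set.range (((q.out : GL (Fin n) F) : Matrix (Fin n) (Fin n) F))ᵀ)) S := by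
  intro q _ q' _ h
  have h' := (span_range_transpose_eq_iff q.out q'.out).1 h
  rw [← Quotient.out_eq q, ← Quotient.out_eq q']
  exact QuotientGroup.eq.2 h'

/-- **`Nat.card Fix_γ(GL_n(F) ⧸ GL_n(𝒪)) = #{γ-stable lattices in the class of 𝒪ⁿ}`** (`Set.ncard`; both sides `0` if infinite).
[cite: Kottwitz1986, §3] [cite: Laumon1995, Lemma (5.3.2) p. 136] [cite: Rogawski1990, §4.9 Lemma 4.9.3] -/
theorem natCard_fixedBy_glInt_eq_ncard (γ : GL (Fin n) F) :
    Nat.card (MulAction.fixedBy (GL (Fin n) F ⧸ glInt n F) γ) =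
      {Λ : Submodule 𝒪[F] (Fin n → F) |
        (∃ g : GL (Fin n) F, Λ = Submodule.span 𝒪[F] (Set.range ((g : Matrix (Fin n) (Fin n) F))ᵀ)) ∧
          Λ.map ((Matrix.toLin' (γ : Matrix (Fin n) (Fin n) F)).restrictScalars 𝒪[F]) = Λ}.ncard := by
  rw [← image_fixedBy_glInt_eq γ, (injOn_span_out_glInt _).ncard_image, Nat.card_coe_set_eq]

/-- `encard` form (no finiteness involved): `#Fix_γ(GL_n(F) ⧸ GL_n(𝒪)) = #{γ-stable lattices in the class of 𝒪ⁿ}` in `ℕ∞`. [cite: Kottwitz1986, §3] -/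
theorem encard_fixedBy_glInt_eq (γ : GL (Fin n) F) :
    (MulAction.fixedBy (GL (Fin n) F ⧸ glInt n F) γ).encard =
      {Λ : Submodule 𝒪[F] (Fin n → F) |
        (∃ g : GL (Fin n) F, Λ = Submodule.span 𝒪[F] (Set.range ((g : Matrix (Fin n) (Fin n) F))ᵀ)) ∧
          Λ.map ((Matrix.toLin' (γ : Matrix (Fin n) (Fin n) F)).restrictScalars 𝒪[F]) = Λ}.encard := by
  rw [← image_fixedBy_glInt_eq γ, (injOn_span_out_glInt _).encard_image]

/-- Existence form of the bijection `Fix_γ(GL_n(F) ⧸ GL_n(𝒪)) ≃ {γ-stable lattices in the class of 𝒪ⁿ}`, `gK ↦ Λ(g)`. [cite: Kottwitz1986, §3] -/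
theorem exists_equiv_fixedBy_glInt (γ : GL (Fin n) F) :
    ∃ e : MulAction.fixedBy (GL (Fin n) F ⧸ glInt n F) γ ≃
        {Λ : Submodule 𝒪[F] (Fin n → F) |
          (∃ g : GL (Fin n) F, Λ = Submodule.span 𝒪[F] (Set.range ((g : Matrix (Fin n) (Fin n) F))ᵀ)) ∧
            Λ.map ((Matrix.toLin' (γ : Matrix (Fin n) (Fin n) F)).restrictScalars 𝒪[F]) = Λ},
      ∀ (g : GL (Fin n) F) (h : (g : GL (Fin n) F ⧸ glInt n F) ∈ MulAction.fixedBy (GL (Fin n) F ⧸ glInt n F) γ),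
        ((e ⟨(g : GL (Fin n) F ⧸ glInt n F), h⟩).1 : Submodule 𝒪[F] (Fin n → F)) =
          Submodule.span 𝒪[F] (Set.range ((g : Matrix (Fin n) (Fin n) F))ᵀ) := by
  have hbij := (injOn_span_out_glInt (MulAction.fixedBy (GL (Fin n) F ⧸ glInt n F) γ)).bijOn_image
  rw [image_fixedBy_glInt_eq γ] at hbij
  exact ⟨hbij.equiv _, fun g h => span_range_transpose_out_eq g⟩
end GLn

/-! ## §3 The unitary group of a form: `Fix_γ(U ⧸ U(𝒪))` = `γ`-stable self-dual lattices (over ★ L1) -/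
section Unitary
variable {E : Type*} [Field E] [ValuativeRel E] {n : ℕ} (σ : E →+* E) (J : GL (Fin n) E)
/-- **The dictionary inside `U = U(J)`**: for `u, γ ∈ U`, `γ · Λ(u) = Λ(u) ↔ u K_U ∈ Fix_γ(U ⧸ K_U)`, `K_U = U ∩ GL_n(𝒪)` (`= (glInt n E).subgroupOf U`).
[cite: Kottwitz1992, §7 Cor. 7.3] [cite: Kottwitz1986, §3] -/
theorem map_span_range_transpose_eq_self_iff_smul_mk_eq_unitary
    (γ u : ↥(unitaryGroupOfForm σ (J : Matrix (Fin n) (Fin n) E))) :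
    (Submodule.span 𝒪[E] (Set.range (((u : GL (Fin n) E) : Matrix (Fin n) (Fin n) E))ᵀ)).map
        ((Matrix.toLin' (((γ : GL (Fin n) E) : Matrix (Fin n) (Fin n) E))).restrictScalars 𝒪[E]) =
      Submodule.span 𝒪[E] (Set.range (((u : GL (Fin n) E) : Matrix (Fin n) (Fin n) E))ᵀ) ↔
      ((u : ↥(unitaryGroupOfForm σ (J : Matrix (Fin n) (Fin n) E))) :
          ↥(unitaryGroupOfForm σ (J : Matrix (Fin n) (Fin n) E)) ⧸ (glInt n E).subgroupOf (unitaryGroupOfForm σ (J : Matrix (Fin n) (Fin n) E))) ∈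
        MulAction.fixedBy
          (↥(unitaryGroupOfForm σ (J : Matrix (Fin n) (Fin n) E)) ⧸ (glInt n E).subgroupOf (unitaryGroupOfForm σ (J : Matrix (Fin n) (Fin n) E))) γ := by
  rw [map_span_range_transpose_eq_self_iff, mem_fixedBy_quotient_mk_iff, Subgroup.mem_subgroupOf, Subgroup.coe_mul,
    Subgroup.coe_mul, Subgroup.coe_inv]

/-- **`Nat.card Fix_γ(U ⧸ K_U) = #{Λ(u), u ∈ U | γ Λ(u) = Λ(u)}`** for `U = U(J) ≤ GL_n(E)`, `K_U = U ∩ GL_n(𝒪)`: the fixed-point count of ★ L2 on the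
unitary side is the number of `γ`-stable lattices in the `U`-orbit of `𝒪ⁿ` (= the self-dual ones, `exists_mem_unitary_span_eq_iff_selfDual`).
[cite: Kottwitz1992, §7 Cor. 7.3] [cite: Rogawski1990, §4.9 Prop. 4.9.1 (b) p. 55] -/
theorem natCard_fixedBy_unitary_eq_ncard (γ : ↥(unitaryGroupOfForm σ (J : Matrix (Fin n) (Fin n) E))) :
    Nat.card (MulAction.fixedBy
        (↥(unitaryGroupOfForm σ (J : Matrix (Fin n) (Fin n) E)) ⧸ (glInt n E).subgroupOf (unitaryGroupOfForm σ (J : Matrix (Fin n) (Fin n) E))) γ) =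
      {Λ : Submodule 𝒪[E] (Fin n → E) |
        (∃ u ∈ unitaryGroupOfForm σ (J : Matrix (Fin n) (Fin n) E), Λ = Submodule.span 𝒪[E] (Set.range ((u : Matrix (Fin n) (Fin n) E))ᵀ)) ∧
          Λ.map ((Matrix.toLin' (((γ : GL (Fin n) E) : Matrix (Fin n) (Fin n) E))).restrictScalars 𝒪[E]) = Λ}.ncard := by
  -- the map `q ↦ Λ(out q)` on `U ⧸ K_U`
  set Φ : ↥(unitaryGroupOfForm σ (J : Matrix (Fin n) (Fin n) E)) ⧸ (glInt n E).subgroupOf (unitaryGroupOfForm σ (J : Matrix (Fin n) (Fin n) E)) →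
      Submodule 𝒪[E] (Fin n → E) := fun q =>
    Submodule.span 𝒪[E] (Set.range ((((q.out : ↥(unitaryGroupOfForm σ (J : Matrix (Fin n) (Fin n) E))) : GL (Fin n) E) :
      Matrix (Fin n) (Fin n) E))ᵀ) with hΦ
  -- `Λ(out (u K_U)) = Λ(u)`
  have hout : ∀ u : ↥(unitaryGroupOfForm σ (J : Matrix (Fin n) (Fin n) E)),
      Φ (u : ↥(unitaryGroupOfForm σ (J : Matrix (Fin n) (Fin n) E)) ⧸ (glInt n E).subgroupOf (unitaryGroupOfForm σ (J : Matrix (Fin n) (Fin n) E))) =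
        Submodule.span 𝒪[E] (Set.range ((((u : GL (Fin n) E)) : Matrix (Fin n) (Fin n) E))ᵀ) := by
    intro u
    obtain ⟨k, hk⟩ := QuotientGroup.mk_out_eq_mul ((glInt n E).subgroupOf (unitaryGroupOfForm σ (J : Matrix (Fin n) (Fin n) E))) u
    rw [hΦ]
    simp only []
    rw [hk, Subgroup.coe_mul, eq_comm, span_range_transpose_eq_iff, inv_mul_cancel_left]
    exact (Subgroup.mem_subgroupOf).1 k.2
  have hinj : Set.InjOn Φ (MulAction.fixedBy
      (↥(unitaryGroupOfForm σ (J : Matrix (Fin n) (Fin n) E)) ⧸ (glInt n E).subgroupOf (unitaryGroupOfForm σ (J : Matrix (Fin n) (Fin n) E))) γ) := by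
    intro q _ q' _ h
    have h' := (span_range_transpose_eq_iff
      ((q.out : ↥(unitaryGroupOfForm σ (J : Matrix (Fin n) (Fin n) E))) : GL (Fin n) E)
      ((q'.out : ↥(unitaryGroupOfForm σ (J : Matrix (Fin n) (Fin n) E))) : GL (Fin n) E)).1 h
    rw [← Quotient.out_eq q, ← Quotient.out_eq q']
    refine QuotientGroup.eq.2 ((Subgroup.mem_subgroupOf).2 ?_)
    rw [Subgroup.coe_mul, Subgroup.coe_inv]
    exact h'
  have himage : Φ '' MulAction.fixedBy
      (↥(unitaryGroupOfForm σ (J : Matrix (Fin n) (Fin n) E)) ⧸ (glInt n E).subgroupOf (unitaryGroupOfForm σ (J : Matrix (Fin n) (Fin n) E))) γ =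
      {Λ : Submodule 𝒪[E] (Fin n → E) |
        (∃ u ∈ unitaryGroupOfForm σ (J : Matrix (Fin n) (Fin n) E), Λ = Submodule.span 𝒪[E] (Set.range ((u : Matrix (Fin n) (Fin n) E))ᵀ)) ∧
          Λ.map ((Matrix.toLin' (((γ : GL (Fin n) E) : Matrix (Fin n) (Fin n) E))).restrictScalars 𝒪[E]) = Λ} := by
    ext Λ
    simp only [mem_image, mem_setOf_eq]
    constructor
    · rintro ⟨q, hq, rfl⟩
      induction q using QuotientGroup.induction_on with
      | H u =>
        rw [hout u]
        exact ⟨⟨u, u.2, rfl⟩, (map_span_range_transpose_eq_self_iff_smul_mk_eq_unitary σ J γ u).2 hq⟩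
    · rintro ⟨⟨u, hu, rfl⟩, hΛ⟩
      exact ⟨((⟨u, hu⟩ : ↥(unitaryGroupOfForm σ (J : Matrix (Fin n) (Fin n) E))) :
          ↥(unitaryGroupOfForm σ (J : Matrix (Fin n) (Fin n) E)) ⧸ (glInt n E).subgroupOf (unitaryGroupOfForm σ (J : Matrix (Fin n) (Fin n) E))),
        (map_span_range_transpose_eq_self_iff_smul_mk_eq_unitary σ J γ ⟨u, hu⟩).1 hΛ, hout ⟨u, hu⟩⟩
  calc Nat.card (MulAction.fixedBy
          (↥(unitaryGroupOfForm σ (J : Matrix (Fin n) (Fin n) E)) ⧸ (glInt n E).subgroupOf (unitaryGroupOfForm σ (J : Matrix (Fin n) (Fin n) E))) γ)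
      = (Φ '' MulAction.fixedBy
          (↥(unitaryGroupOfForm σ (J : Matrix (Fin n) (Fin n) E)) ⧸ (glInt n E).subgroupOf (unitaryGroupOfForm σ (J : Matrix (Fin n) (Fin n) E))) γ).ncard := by
        rw [hinj.ncard_image, Nat.card_coe_set_eq]
    _ = _ := by rw [himage]

/-- **★ L1 docking: the lattices `Λ(u)`, `u ∈ U(J)`, are exactly the lattices `Λ(g)` with UNIMODULAR GRAM MATRIX `(σg)ᵀ J g ∈ GL_n(𝒪)`** (the
self-dual lattices in the class of `𝒪ⁿ`), under the hypotheses of ★ `exists_mem_unitaryGroupOfForm_mul_iff` (`σ` an involution preserving `𝒪`,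
Jacobowitz's (trace) and (norm), `J ∈ GL_n(𝒪)` `σ`-hermitian). Hence `Nat.card Fix_γ(U ⧸ K_U)` (`natCard_fixedBy_unitary_eq_ncard`) is the number of
`γ`-stable SELF-DUAL lattices. [cite: Jacobowitz1962, §7 Thm. 7.1] [cite: Kottwitz1992, §7 Lemma 7.2, Cor. 7.3] -/
theorem exists_mem_unitary_span_eq_iff_selfDual (hσσ : ∀ x, σ (σ x) = x) (hσO : ∀ x : 𝒪[E], σ x ∈ 𝒪[E])
    (htr : ∃ b : 𝒪[E], (b : E) + σ b = 1) (hnorm : ∀ u : 𝒪[E], IsUnit u → σ u = u → ∃ t : 𝒪[E], (t : E) * σ t = u)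
    (hJ : J ∈ glInt n E) (hJh : ((J : Matrix (Fin n) (Fin n) E).map σ)ᵀ = J) (Λ : Submodule 𝒪[E] (Fin n → E)) :
    (∃ u ∈ unitaryGroupOfForm σ (J : Matrix (Fin n) (Fin n) E), Λ = Submodule.span 𝒪[E] (Set.range ((u : Matrix (Fin n) (Fin n) E))ᵀ)) ↔
      ∃ g : GL (Fin n) E, (∃ J' ∈ glInt n E, (J' : Matrix (Fin n) (Fin n) E) = formCongr σ g (J : Matrix (Fin n) (Fin n) E)) ∧
        Λ = Submodule.span 𝒪[E] (Set.range ((g : Matrix (Fin n) (Fin n) E))ᵀ) := by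
  constructor
  · rintro ⟨u, hu, rfl⟩
    refine ⟨u, (UnitaryGroup.exists_mem_unitaryGroupOfForm_mul_iff σ hσσ hσO htr hnorm J hJ hJh u).1 ⟨u, hu, 1, one_mem _, (mul_one u).symm⟩, rfl⟩
  · rintro ⟨g, hg, rfl⟩
    obtain ⟨u, hu, k, hk, rfl⟩ := (UnitaryGroup.exists_mem_unitaryGroupOfForm_mul_iff σ hσσ hσO htr hnorm J hJ hJh g).2 hg
    refine ⟨u, hu, ?_⟩
    rw [eq_comm, span_range_transpose_eq_iff, inv_mul_cancel_left]
    exact hk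
end Unitary
end Literature.NumberTheory.Automorphic

end
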